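import Literature.Analysis.FluidPDE.OnsagerBDSVPerturbationER
import Literature.Analysis.FluidPDE.AntidivergenceLinear
import Literature.Analysis.FunctionSpaces.ContDiffHolderAlgebra
import HarnessLib

/-!
# The BDSV stress estimate (Prop. 6.1) split along §6.1: Nash, transport and oscillation errors

Buckmaster–De Lellis–Székelyhidi–Vicol (BDSV), *Onsager's conjecture for admissible weak
solutions*, CPAM 72 (2019) = arXiv:1701.08678, prove the stress estimate of the perturbation
step of their scheme,

  Prop. 6.1, (6.1): `‖R̊_{q+1}‖₀ ≲ δ_{q+1}^{1/2} δ_q^{1/2} λ_q / λ_{q+1}^{1-4α}`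

— the named fact `BDSV.stressEstimate` of `OnsagerBDSVPerturbation.lean` — by splitting the new
stress (§5.4, `BDSV.newStress`; arXiv (5.21)) into the three pieces

  `R̊_{q+1} = ℛ(w_{q+1}·∇ v̄_q)            ` (Nash error)
  `        + ℛ(∂ₜ w_{q+1} + v̄_q·∇ w_{q+1}) ` (transport error)
  `        + ℛ div(w_{q+1} ⊗ w_{q+1} - R̄_q)` (oscillation error),

estimating each in `C^α` — §6.1.1 (arXiv (6.5)), §6.1.2 (arXiv (6.8)), §6.1.3 (arXiv (6.12)), all
through the stationary phase estimate Prop. C.2 for `ℛ` applied mode by mode to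
`w_{q+1} = Σ_{i,k} (∇Φ_i⁻¹ b_{i,k} + c_{i,k}) e^{iλ_{q+1} k·Φ_i}` and the amplitude bounds of
Props. 5.7, 5.9 — and concluding in §6.1.4: "Clearly (6.1) follows from (6.5), (6.8), (6.12) and
(5.21)." This file performs exactly this split, for the honest construction of
`OnsagerBDSVPerturbation.lean`:

* the three sources as definitions: `BDSV.nashSource = (w·∇)v̄_q`,
  `BDSV.transportSource = ∂ₜw + (v̄_q·∇)w` (the advective derivative `BDSV.advectiveDeriv` of `w`),
  `BDSV.oscillationSource = div(w ⊗ w - R̄_q)`; `BDSV.stressSource = transport + Nash + oscillation`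
  holds by `rfl` (`BDSV.stressSource_eq_sum`), so that `R̊_{q+1} = ℛ transport + ℛ Nash + ℛ osc`
  on `[0,T]` by linearity of `ℛ` on smooth fields (`BDSV.SmoothData.newStress_eq_sum`);
* the three error estimates as NAMED FACTS sharing the quantifier prefix of
  `BDSV.stressEstimate` (`∀ 𝔚 c₀ C_η β b, ∃ α₀, ∀ α < α₀, ∃ N̄, ∀ C_in C₀, ∃ C a₀, ∀ a ≥ a₀, ∀ S,
  hypotheses → ∀ data, …`): `BDSV.nashErrorEstimate` (§6.1.1), `BDSV.transportErrorEstimate`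
  (§6.1.2), `BDSV.oscillationErrorEstimate` (§6.1.3), each a bound of the spatial `C^{0,α}` norms
  on `[0,T]` (`BDSV.HolderSupLE … 0 α`, the norm the source uses) by the scale
  `δ_{q+1}^{1/2} δ_q^{1/2} λ_q λ_{q+1}^{-(1-4α)}` of (6.1) (see "Design choices" for the exponent);
* the PROVED assembly (§6.1.4)
  `BDSV.stressEstimate_of_errors : nashErrorEstimate → transportErrorEstimate →
  oscillationErrorEstimate → stressEstimate`, whose ingredients are: linearity of `ℛ` on smooth
  fields (`Torus.antidivergence_add`, `AntidivergenceLinear.lean`); smoothness of the three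
  sources (`OnsagerBDSVPerturbationSmooth.lean`) under the standing hypotheses, which needs
  `ρ_q > 0`, i.e. the lower bound of Lemma 5.4 (arXiv (5.11)) — here, exactly as in the
  discharge of F₅ (`OnsagerBDSVPerturbationER.lean`), from `2δ_{q+2} ≤ δ_{q+1} λ_q^{-α}`, valid
  for `α < 2βb(b-1)` and `a` large (`BDSV.exists_threshold_amp_succ_succ`), together with the
  energy gap of `BDSV.PerturbationHypotheses`; and `‖f(x)‖ ≤ ‖f‖_{C^{0,α}}`.

## Numbering

Sections, lemmas, propositions and corollaries are cited as printed (they agree between the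
journal and the arXiv version). Displayed equations are cited by the numbers of the arXiv version
arXiv:1701.08678v1, the text held here, and marked `arXiv (m.n)`; these were read off the TeX
source (`\numberwithin{equation}{section}`, labels `e:final_R_est` = (6.1), `e:Nash_est` = (6.5),
`e:ell-lambdaq+1` = (6.4), `e:trans_est` = (6.8), `e:osc_est` = (6.12), `e:R:q+1` = (5.21),
`e:rho_range` = (5.11)). The sibling files `OnsagerBDSVPerturbation*.lean` quote some displays by
other numbers ("(5.23)" for the new stress, "(5.28)" for the curl form of `w_{q+1}`, "(5.2)" for
the energy gap); here those objects are referred to by their Lean names.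

## Design choices

* The facts are stated for the `C^{0,α}` norm as printed (the per-mode bounds arXiv (6.2)–(6.3)
  and the conclusions arXiv (6.8), (6.12) are `‖·‖_α` bounds; Prop. 6.1 itself is a `‖·‖₀`
  bound), uniformly on `[0,T]`; the implicit constant `C` and the thresholds are quantified
  exactly as in `BDSV.stressEstimate` (the constant depends on `β, α, M, N` — §5.5: "the symbol
  `≲` denotes a dependence of the constants in the estimates from `N`, `α`, `β` and `M`" — on the
  Mikado profile (Remark 5.2), on `c₀`, on the cut-off constants `C(n,m)` of Lemma 5.3 and on
  `C_in`; `α` is "sufficiently small", `N` "suitably chosen" (§6.1.1) and `a ≫ 1`).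
* The exponent of `λ_{q+1}`. The concluding displays print the powers `λ_{q+1}^{-(1-α)}`
  (arXiv (6.5)), `λ_{q+1}^{-(1-3α)}` (arXiv (6.8)) and `λ_{q+1}^{-(1-α)}` (arXiv (6.12)) in front of
  `δ_{q+1}^{1/2} δ_q^{1/2} λ_q`, absorbing factors `λ_q^{O(α)} ≤ λ_{q+1}^{O(α)}` tacitly: the display
  for the term `d_{i,k}` of §6.1.2 ends with `λ_{q+1}^{-(1-4α)}` (via `ℓ^{-2α} ≤ λ_q^{3α} ≤ λ_{q+1}^{3α}`),
  and in §6.1.3 the step "`δ_{q+1}/(ℓ λ_{q+1}^{1-α}) ≲ δ_{q+1}^{1/2} δ_q^{1/2} λ_q / λ_{q+1}^{1-α}`"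
  (arXiv (6.9), (6.11)) drops the factor `λ_q^{3α/2}` of `δ_{q+1} ℓ^{-1} = δ_{q+1}^{1/2} δ_q^{1/2}
  λ_q^{1+3α/2}` ((2.19), the definition of `ℓ`). What §6.1.4 uses, and what the printed
  derivations give uniformly in `q`, is each error bounded by the scale
  `δ_{q+1}^{1/2} δ_q^{1/2} λ_q λ_{q+1}^{-(1-4α)}` of (6.1); the three facts are transcribed with this
  common exponent (a statement implied by each printed display, never stronger than it).
* arXiv (6.5) prints a stray factor `|k|^{-6}` after the sum over `k` has been taken; it is
  dropped.

## What is not here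

The proofs of the three error estimates: §6.1.1–6.1.3 through Prop. C.2 (stationary phase for
`ℛ`, resting on the Calderón–Zygmund bound Prop. C.1), Props. 5.7 and 5.9, Lemmas 5.4–5.5, the
Fourier expansion of the Mikado flows (arXiv (5.4)–(5.7)) and the identities arXiv (5.18)
(Lie advection), (6.6), (6.10). They are the subject of later files; `BDSV.stressEstimate_holds`
then follows from `BDSV.stressEstimate_of_errors`.

## References

* T. Buckmaster, C. De Lellis, L. Székelyhidi Jr., V. Vicol, *Onsager's conjecture for admissible
  weak solutions*, Comm. Pure Appl. Math. 72 (2019) 229–274 = arXiv:1701.08678: §5.4 (the new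
  stress, arXiv (5.21)); §6.1 Prop. 6.1 (6.1); §6.1.1 (arXiv (6.2)–(6.5)); §6.1.2
  (arXiv (6.6)–(6.8)); §6.1.3 (arXiv (6.9)–(6.12)); §6.1.4; Lemma 5.4 (arXiv (5.11)) and its proof
  ("a trivial consequence of estimate (2.34) and the inequality `4δ_{q+2} ≤ δ_{q+1}`");
  §5.5 Props. 5.7, 5.9; App. C Prop. C.2.
-/

open MeasureTheory Set
open scoped NNReal ENNReal ContDiff Matrix Matrix.Norms.Elementwise

noncomputable section

namespace Literature.Analysis.FluidPDE

namespace BDSV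

open FunctionSpaces FunctionSpaces.Torus

/-- The flat three-torus `T³ = (ℝ/ℤ)³`, local notation. -/
local notation "𝕋³" => UnitAddTorus (Fin 3)

/-- Euclidean `ℝ³`, local notation. -/
local notation "ℝ³" => EuclideanSpace ℝ (Fin 3)

/-! ## The three sources of the new stress (§5.4) -/

section Sources

variable (P : Params) (S : Setting)

/-- The **Nash term** `(w_{q+1}·∇) v̄_q` of the new stress (§5.4, `BDSV.newStress`; arXiv
(5.21)): the field under `ℛ` in the "Nash error". [cite: BuckmasterEtAl2018, §5.4 (arXiv (5.21))] -/
def nashSource (𝔚 : MikadoDatum mikadoRadius) (η : ℕ → ℝ → 𝕋³ → ℝ) (D : ℕ → ℝ → 𝕋³ → ℝ³)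
    (t : ℝ) (x : 𝕋³) : ℝ³ :=
  convect (perturbation P S 𝔚 η D t) (S.vbar t) x

/-- The **transport term** `∂ₜ w_{q+1} + (v̄_q·∇) w_{q+1} = D_{t,q} w_{q+1}` of the new stress
(§5.4; arXiv (5.21)): the field under `ℛ` in the "Transport error"; the time derivative is
one-sided within `[0,T]`, as in `BDSV.stressSource`. This is
`BDSV.advectiveDeriv S.T S.vbar (BDSV.perturbation …)` (`rfl`). [cite: BuckmasterEtAl2018, §5.4 (arXiv (5.21))] -/
def transportSource (𝔚 : MikadoDatum mikadoRadius) (η : ℕ → ℝ → 𝕋³ → ℝ) (D : ℕ → ℝ → 𝕋³ → ℝ³)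
    (t : ℝ) (x : 𝕋³) : ℝ³ :=
  timeDerivWithin (Icc 0 S.T) (perturbation P S 𝔚 η D) t x +
    convect (S.vbar t) (perturbation P S 𝔚 η D t) x

/-- The **oscillation term** `div(w_{q+1} ⊗ w_{q+1} - R̄_q)` of the new stress (§5.4; arXiv
(5.21)): the field under `ℛ` in the "Oscillation error"; `w ⊗ w` has columns `w_j w`,
`R̄_q = BDSV.stressSum`. [cite: BuckmasterEtAl2018, §5.4 (arXiv (5.21))] -/
def oscillationSource (𝔚 : MikadoDatum mikadoRadius) (η : ℕ → ℝ → 𝕋³ → ℝ) (D : ℕ → ℝ → 𝕋³ → ℝ³)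
    (t : ℝ) (x : 𝕋³) : ℝ³ :=
  Torus.tensorDivergence
    (fun y j => perturbation P S 𝔚 η D t y j • perturbation P S 𝔚 η D t y - stressSum P S η t y j) x

variable {P S}

/-- The transport term is the advective derivative of the perturbation along `v̄_q`. [folklore] -/
theorem transportSource_eq_advectiveDeriv (𝔚 : MikadoDatum mikadoRadius) (η : ℕ → ℝ → 𝕋³ → ℝ)
    (D : ℕ → ℝ → 𝕋³ → ℝ³) :
    transportSource P S 𝔚 η D = advectiveDeriv S.T S.vbar (perturbation P S 𝔚 η D) :=
  rfl

/-- The source `F` of the new stress (`BDSV.stressSource`, §5.4; arXiv (5.21)) is the sum of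
the transport, Nash and oscillation terms. [cite: BuckmasterEtAl2018, §5.4 (arXiv (5.21))] -/
theorem stressSource_eq_sum (𝔚 : MikadoDatum mikadoRadius) (η : ℕ → ℝ → 𝕋³ → ℝ)
    (D : ℕ → ℝ → 𝕋³ → ℝ³) (t : ℝ) (x : 𝕋³) :
    stressSource P S 𝔚 η D t x =
      transportSource P S 𝔚 η D t x + nashSource P S 𝔚 η D t x + oscillationSource P S 𝔚 η D t x :=
  rfl

end Sources

/-! ## The three error estimates of §6.1 as named facts -/

section Facts

/-- **The Nash error estimate** (BDSV §6.1.1, concluding display, arXiv (6.5): "Summing over the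
frequencies and using that `Σ_{k ∈ ℤ³∖{0}} |k|^{-6} < ∞`, we achieve
`ℛ(w_{q+1}·∇v̄_q) ≲ δ_{q+1}^{1/2} δ_q^{1/2} λ_q / λ_{q+1}^{1-α}`", the norm being the spatial `C^α`
norm of the per-mode bounds arXiv (6.2)–(6.3), uniformly in `t`; proof: Prop. C.2 applied to each
mode `(∇Φ_i⁻¹ b_{i,k} + c_{i,k}) e^{iλ_{q+1}k·Φ_i} · ∇v̄_q` with Props. 5.7, 5.9, the choice of `N`
for `α` small (§6.1.1) and arXiv (6.4) `ℓ λ_{q+1} ≥ 1`, for `a` large). Transcription: the prefix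
of `BDSV.stressEstimate`; `‖·‖_α` on `[0,T]` by `BDSV.HolderSupLE … 0 α`; the Nash term is
`BDSV.nashSource`; the power of `λ_{q+1}` is the `λ_{q+1}^{-(1-4α)}` of (6.1), implied by the printed
`λ_{q+1}^{-(1-α)}` (module docstring, "Design choices"). [cite: BuckmasterEtAl2018, §6.1.1 (arXiv (6.5)) with Prop. 6.1 (6.1)] -/
def nashErrorEstimate : Prop :=
  ∀ (𝔚 : MikadoDatum mikadoRadius) (c₀ : ℝ), 0 < c₀ → ∀ Cη : ℕ → ℕ → ℝ,
    ∀ β : ℝ, 0 < β → β < 1 / 3 → ∀ b : ℝ, 1 < b → b < (1 - β) / (2 * β) →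
      ∃ α₀ : ℝ, 0 < α₀ ∧ ∀ α : ℝ, 0 < α → α < α₀ → ∃ Nbar : ℕ, ∀ Cin C₀ : ℝ,
        ∃ C a₀ : ℝ, 1 < a₀ ∧ ∀ a : ℝ, a₀ ≤ a → ∀ S : Setting,
          PerturbationHypotheses ⟨β, α, a, b⟩ S Nbar Cin C₀ →
            ∀ 𝒟 : PerturbationData ⟨β, α, a, b⟩ S c₀ Cη,
              HolderSupLE S.T
                (fun t => Torus.antidivergence (nashSource ⟨β, α, a, b⟩ S 𝔚 𝒟.cut.η 𝒟.D t))
                0 (Real.toNNReal α)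
                (C * (Real.sqrt (amp β a b (S.q + 1)) * Real.sqrt (amp β a b S.q) *
                  freq a b S.q * freq a b (S.q + 1) ^ (-1 + 4 * α)))

/-- **The transport error estimate** (BDSV §6.1.2, concluding display, arXiv (6.8): "summing
over `k ≠ 0` we reach the inequality
`‖ℛ(∂ₜw_{q+1} + v̄_q·∇w_{q+1})‖_α ≲ δ_{q+1}^{1/2} δ_q^{1/2} λ_q / λ_{q+1}^{1-3α}`"; proof: the
Lie-advection identity arXiv (5.18) gives arXiv (6.6), whose modes `(∇v̄_q)ᵀ∇Φ_i⁻¹ b_{i,k}`,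
`d_{i,k}` and `D_{t,q} c_{i,k}` are fed to Prop. C.2 (arXiv (6.7)) with Props. 5.7, 5.9, using
`τ_q^{-1} = δ_q^{1/2} λ_q ℓ^{-2α}`, `ℓ^{-2α} ≤ λ_q^{3α} ≤ λ_{q+1}^{3α}` and arXiv (6.4) — the
display for the `d_{i,k}` term ends with `λ_{q+1}^{-(1-4α)}`). Transcription as in
`BDSV.nashErrorEstimate`, with the power `λ_{q+1}^{-(1-4α)}` of (6.1) (implied by the printed
`λ_{q+1}^{-(1-3α)}`); the transport term is `BDSV.transportSource` (one-sided time derivative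
within `[0,T]`). [cite: BuckmasterEtAl2018, §6.1.2 (arXiv (6.8)) with Prop. 6.1 (6.1)] -/
def transportErrorEstimate : Prop :=
  ∀ (𝔚 : MikadoDatum mikadoRadius) (c₀ : ℝ), 0 < c₀ → ∀ Cη : ℕ → ℕ → ℝ,
    ∀ β : ℝ, 0 < β → β < 1 / 3 → ∀ b : ℝ, 1 < b → b < (1 - β) / (2 * β) →
      ∃ α₀ : ℝ, 0 < α₀ ∧ ∀ α : ℝ, 0 < α → α < α₀ → ∃ Nbar : ℕ, ∀ Cin C₀ : ℝ,
        ∃ C a₀ : ℝ, 1 < a₀ ∧ ∀ a : ℝ, a₀ ≤ a → ∀ S : Setting,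
          PerturbationHypotheses ⟨β, α, a, b⟩ S Nbar Cin C₀ →
            ∀ 𝒟 : PerturbationData ⟨β, α, a, b⟩ S c₀ Cη,
              HolderSupLE S.T
                (fun t => Torus.antidivergence (transportSource ⟨β, α, a, b⟩ S 𝔚 𝒟.cut.η 𝒟.D t))
                0 (Real.toNNReal α)
                (C * (Real.sqrt (amp β a b (S.q + 1)) * Real.sqrt (amp β a b S.q) *
                  freq a b S.q * freq a b (S.q + 1) ^ (-1 + 4 * α)))

/-- **The oscillation error estimate** (BDSV §6.1.3, concluding display, arXiv (6.12): "Clearly,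
(6.9) and (6.11) give
`‖ℛ div(-R̄_q + w_{q+1} ⊗ w_{q+1})‖_α ≲ δ_{q+1}^{1/2} δ_q^{1/2} λ_q / λ_{q+1}^{1-α}`"; proof: the
split `𝒪₁ + 𝒪₂`, `𝒪₂` by arXiv (6.9) and Cor. 5.8, `𝒪₁` by the identity arXiv (6.10)
`w_{o,i} ⊗ w_{o,i} = R_{q,i} + Σ_k ρ_{q,i} ∇Φ_i⁻¹ C_k(R̃_{q,i}) ∇Φ_i⁻ᵀ e^{iλ_{q+1}k·Φ_i}`, `C_k k = 0`
(arXiv (5.7)), and Prop. C.2 (arXiv (6.11)), for `N` large and `a ≫ 1`; both (6.9) and (6.11)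
pass from `δ_{q+1} ℓ^{-1} λ_{q+1}^{-(1-α)} = δ_{q+1}^{1/2} δ_q^{1/2} λ_q^{1+3α/2} λ_{q+1}^{-(1-α)}` to the
displayed right-hand side, i.e. absorb `λ_q^{3α/2} ≤ λ_{q+1}^{3α/2}`). Transcription as in
`BDSV.nashErrorEstimate`, with the power `λ_{q+1}^{-(1-4α)}` of (6.1) (implied by the printed
`λ_{q+1}^{-(1-α)}`, and by the derived `λ_{q+1}^{-(1-5α/2)}`); the oscillation term is
`BDSV.oscillationSource`. [cite: BuckmasterEtAl2018, §6.1.3 (arXiv (6.12)) with Prop. 6.1 (6.1)] -/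
def oscillationErrorEstimate : Prop :=
  ∀ (𝔚 : MikadoDatum mikadoRadius) (c₀ : ℝ), 0 < c₀ → ∀ Cη : ℕ → ℕ → ℝ,
    ∀ β : ℝ, 0 < β → β < 1 / 3 → ∀ b : ℝ, 1 < b → b < (1 - β) / (2 * β) →
      ∃ α₀ : ℝ, 0 < α₀ ∧ ∀ α : ℝ, 0 < α → α < α₀ → ∃ Nbar : ℕ, ∀ Cin C₀ : ℝ,
        ∃ C a₀ : ℝ, 1 < a₀ ∧ ∀ a : ℝ, a₀ ≤ a → ∀ S : Setting,
          PerturbationHypotheses ⟨β, α, a, b⟩ S Nbar Cin C₀ →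
            ∀ 𝒟 : PerturbationData ⟨β, α, a, b⟩ S c₀ Cη,
              HolderSupLE S.T
                (fun t => Torus.antidivergence (oscillationSource ⟨β, α, a, b⟩ S 𝔚 𝒟.cut.η 𝒟.D t))
                0 (Real.toNNReal α)
                (C * (Real.sqrt (amp β a b (S.q + 1)) * Real.sqrt (amp β a b S.q) *
                  freq a b S.q * freq a b (S.q + 1) ^ (-1 + 4 * α)))

end Facts

/-! ## Positivity of `ρ_q` (Lemma 5.4) and smoothness of the construction -/

section Positivity

variable {P : Params} {S : Setting} {Nbar : ℕ} {Cin C₀ : ℝ}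

/-- **`ρ_q > 0` on `[0,T]`** (the lower bound of Lemma 5.4, arXiv (5.11), qualitatively): under
the energy gap `δ_{q+1} λ_q^{-α}/2 ≤ e(t) - ∫ |v̄_q|²` of `BDSV.PerturbationHypotheses` and
`2δ_{q+2} ≤ δ_{q+1} λ_q^{-α}` (`BDSV.exists_threshold_amp_succ_succ`), one has
`3ρ_q = e - δ_{q+2}/2 - ∫|v̄_q|² ≥ δ_{q+1} λ_q^{-α}/4 > 0`. [cite: BuckmasterEtAl2018, Lemma 5.4 (arXiv (5.11))] -/
theorem PerturbationHypotheses.rhoQ_pos (H : PerturbationHypotheses P S Nbar Cin C₀) (ha : 1 ≤ P.a)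
    (hδ : 2 * amp P.β P.a P.b (S.q + 2) ≤ amp P.β P.a P.b (S.q + 1) * freq P.a P.b S.q ^ (-P.α))
    {t : ℝ} (ht : t ∈ Icc 0 S.T) : 0 < rhoQ P S t := by
  have h1 := (H.energy_gap t ht).1
  have hpos : 0 < amp P.β P.a P.b (S.q + 1) * freq P.a P.b S.q ^ (-P.α) :=
    mul_pos (amp_pos ha _) (Real.rpow_pos_of_pos (freq_pos ha _) _)
  unfold rhoQ
  linarith

/-- `∑_j ∫ η_j² ≥ c₀ > 0` on `[0,T]` (property (v) of §5.2). [cite: BuckmasterEtAl2018, §5.2 (v)] -/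
theorem PerturbationData.etaMass_pos {c₀ : ℝ} {Cη : ℕ → ℕ → ℝ} (𝒟 : PerturbationData P S c₀ Cη)
    (hc₀ : 0 < c₀) {t : ℝ} (ht : t ∈ Icc 0 S.T) : 0 < etaMass P S 𝒟.cut.η t :=
  lt_of_lt_of_le hc₀ (𝒟.cut.sum_sq_ge t ht)

/-- **The construction is smooth under the standing hypotheses**: given the energy gap,
`2δ_{q+2} ≤ δ_{q+1} λ_q^{-α}` (so `ρ_q > 0`) and `c₀ > 0`, the data of the perturbation step
satisfy `BDSV.SmoothData` (all fields jointly smooth on `[0,T] × T³`, `ρ_q > 0`, `∑∫η_j² > 0`;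
cf. the same construction inside `BDSV.newTriple_isEulerReynolds_holds`). [folklore] -/
theorem PerturbationHypotheses.smoothData (H : PerturbationHypotheses P S Nbar Cin C₀) (ha : 1 ≤ P.a)
    (hδ : 2 * amp P.β P.a P.b (S.q + 2) ≤ amp P.β P.a P.b (S.q + 1) * freq P.a P.b S.q ^ (-P.α))
    {c₀ : ℝ} (hc₀ : 0 < c₀) {Cη : ℕ → ℕ → ℝ} (𝒟 : PerturbationData P S c₀ Cη) :
    SmoothData P S 𝒟.cut.η 𝒟.D where
  pos_T := H.pos_T
  e := H.profile.smooth
  vbar := H.eulerReynolds.smooth_velocity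
  pbar := H.eulerReynolds.smooth_pressure
  Rbar := H.eulerReynolds.smooth_stress
  eta := 𝒟.cut.smooth
  disp i := (𝒟.flow i).smooth
  rho_pos _ ht := H.rhoQ_pos ha hδ ht
  mass_pos _ ht := 𝒟.etaMass_pos hc₀ ht

end Positivity

/-! ## Splitting the new stress -/

section Split

variable {P : Params} {S : Setting} {η : ℕ → ℝ → 𝕋³ → ℝ} {D : ℕ → ℝ → 𝕋³ → ℝ³}

namespace SmoothData

variable (h : SmoothData P S η D)
include h

/-- The Nash term is jointly smooth. [folklore] -/
theorem nashSource (𝔚 : MikadoDatum mikadoRadius) :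
    IsSmoothSpaceTimeOn (Icc 0 S.T) (BDSV.nashSource P S 𝔚 η D) :=
  (h.perturbation 𝔚).convect h.vbar h.uniqueDiffOn

/-- The transport term is jointly smooth. [folklore] -/
theorem transportSource (𝔚 : MikadoDatum mikadoRadius) :
    IsSmoothSpaceTimeOn (Icc 0 S.T) (BDSV.transportSource P S 𝔚 η D) :=
  ((h.perturbation 𝔚).timeDerivWithin h.uniqueDiffOn).add
    (h.vbar.convect (h.perturbation 𝔚) h.uniqueDiffOn)

/-- The oscillation term is jointly smooth. [folklore] -/
theorem oscillationSource (𝔚 : MikadoDatum mikadoRadius) :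
    IsSmoothSpaceTimeOn (Icc 0 S.T) (BDSV.oscillationSource P S 𝔚 η D) :=
  (h.oscillationTensor 𝔚).tensorDivergence h.uniqueDiffOn

/-- **The new stress split into its three errors** (§5.4, arXiv (5.21)): on `[0,T]`,
`R̊_{q+1} = ℛ(D_{t,q} w) + ℛ((w·∇)v̄_q) + ℛ div(w ⊗ w - R̄_q)` (linearity of `ℛ` on the smooth
slices of the three sources). [cite: BuckmasterEtAl2018, §5.4 (arXiv (5.21))] -/
theorem newStress_eq_sum (𝔚 : MikadoDatum mikadoRadius) {t : ℝ} (ht : t ∈ Icc 0 S.T) (x : 𝕋³) :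
    BDSV.newStress P S 𝔚 η D t x =
      Torus.antidivergence (BDSV.transportSource P S 𝔚 η D t) x +
        Torus.antidivergence (BDSV.nashSource P S 𝔚 η D t) x +
        Torus.antidivergence (BDSV.oscillationSource P S 𝔚 η D t) x := by
  have h1 := (h.transportSource 𝔚).isSmooth_slice ht
  have h2 := (h.nashSource 𝔚).isSmooth_slice ht
  have h3 := (h.oscillationSource 𝔚).isSmooth_slice ht
  have hF : BDSV.stressSource P S 𝔚 η D t = fun y =>
      (BDSV.transportSource P S 𝔚 η D t + BDSV.nashSource P S 𝔚 η D t) y +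
        BDSV.oscillationSource P S 𝔚 η D t y := rfl
  rw [BDSV.newStress, hF, Torus.antidivergence_add_apply (h1.add h2) h3,
    Torus.antidivergence_add h1 h2, Pi.add_apply]

end SmoothData

end Split

/-! ## Assembly (§6.1.4) -/

section Assembly

/-- From `‖f(t)‖_{C^{N,r}} ≤ B` on `[0,T]` to the pointwise bound `‖f(t,x)‖ ≤ max B 0`
(`‖f(x)‖ ≤ ‖f‖_{C^{N,r}}`). [folklore] -/
theorem HolderSupLE.norm_le {F : Type*} [NormedAddCommGroup F] [NormedSpace ℝ F] {T : ℝ}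
    {f : ℝ → 𝕋³ → F} {N : ℕ} {r : ℝ≥0} {B : ℝ} (h : HolderSupLE T f N r B) {t : ℝ}
    (ht : t ∈ Icc 0 T) (x : 𝕋³) : ‖f t x‖ ≤ max B 0 := by
  have h1 : ‖f t x‖ₑ ≤ ENNReal.ofReal (max B 0) :=
    ((Torus.enorm_le_eContDiffHolderNorm N r (f t) x).trans (h t ht)).trans
      (ENNReal.ofReal_le_ofReal (le_max_left _ _))
  rw [← ofReal_norm] at h1
  exact (ENNReal.ofReal_le_ofReal_iff (le_max_right _ _)).1 h1

/-- Bookkeeping for one error term: `max (C s) 0 ≤ max C 0 · s` for `s ≥ 0`. [folklore] -/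
theorem max_mul_le_max_mul {C s : ℝ} (hs : 0 ≤ s) : max (C * s) 0 ≤ max C 0 * s :=
  max_le (mul_le_mul_of_nonneg_right (le_max_left _ _) hs) (mul_nonneg (le_max_right _ _) hs)

/-- **Assembly of Prop. 6.1 from the three error estimates** (BDSV §6.1.4: "Clearly (6.1)
follows from (6.5), (6.8), (6.12) and (5.21)", arXiv numbering): the Nash, transport and
oscillation estimates imply the stress estimate (6.1), `BDSV.stressEstimate`. The thresholds are
the extremal ones of the three facts together with `α < βb(b-1)` and the threshold of
`BDSV.exists_threshold_amp_succ_succ` (which make `ρ_q > 0`, so that the construction is smooth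
and `ℛ` splits the new stress into its three terms); the constant is `Σ_j max(C_j, 0)`, using
`‖f(x)‖ ≤ ‖f‖_α`. [cite: BuckmasterEtAl2018, §6.1.4] -/
theorem stressEstimate_of_errors (hN : nashErrorEstimate) (hT : transportErrorEstimate)
    (hO : oscillationErrorEstimate) : stressEstimate := by
  intro 𝔚 c₀ hc₀ Cη β hβ hβ' b hb hb'
  obtain ⟨αN, hαN, hN⟩ := hN 𝔚 c₀ hc₀ Cη β hβ hβ' b hb hb'
  obtain ⟨αT, hαT, hT⟩ := hT 𝔚 c₀ hc₀ Cη β hβ hβ' b hb hb'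
  obtain ⟨αO, hαO, hO⟩ := hO 𝔚 c₀ hc₀ Cη β hβ hβ' b hb hb'
  have hαρ : 0 < β * b * (b - 1) := mul_pos (mul_pos hβ (by linarith)) (by linarith)
  refine ⟨min (min αN αT) (min αO (β * b * (b - 1))),
    lt_min (lt_min hαN hαT) (lt_min hαO hαρ), ?_⟩
  intro α hα hαlt
  have hα1 : α < min αN αT := lt_of_lt_of_le hαlt (min_le_left _ _)
  have hα2 : α < min αO (β * b * (b - 1)) := lt_of_lt_of_le hαlt (min_le_right _ _)
  have hαρ' : α < 2 * β * b * (b - 1) := by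
    have := lt_of_lt_of_le hα2 (min_le_right _ _)
    nlinarith
  obtain ⟨NN, hN⟩ := hN α hα (lt_of_lt_of_le hα1 (min_le_left _ _))
  obtain ⟨NT, hT⟩ := hT α hα (lt_of_lt_of_le hα1 (min_le_right _ _))
  obtain ⟨NO, hO⟩ := hO α hα (lt_of_lt_of_le hα2 (min_le_left _ _))
  refine ⟨max (max NN NT) NO, ?_⟩
  intro Cin C₀
  obtain ⟨CN, aN, haN, hN⟩ := hN Cin C₀
  obtain ⟨CT, aT, haT, hT⟩ := hT Cin C₀
  obtain ⟨CO, aO, haO, hO⟩ := hO Cin C₀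
  obtain ⟨aρ, haρ, hρ⟩ := exists_threshold_amp_succ_succ hb hαρ'
  refine ⟨max CN 0 + max CT 0 + max CO 0, max (max aN aT) (max aO aρ),
    lt_max_of_lt_left (lt_max_of_lt_left haN), ?_⟩
  intro a ha S H 𝒟
  have ha1' : max aN aT ≤ a := le_trans (le_max_left _ _) ha
  have ha2' : max aO aρ ≤ a := le_trans (le_max_right _ _) ha
  have haN' : aN ≤ a := le_trans (le_max_left _ _) ha1'
  have haT' : aT ≤ a := le_trans (le_max_right _ _) ha1'
  have haO' : aO ≤ a := le_trans (le_max_left _ _) ha2'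
  have haρ'' : aρ ≤ a := le_trans (le_max_right _ _) ha2'
  have ha1 : (1 : ℝ) ≤ a := le_trans haN.le haN'
  -- the three estimates for these data
  have eN := hN a haN' S (H.of_le (le_trans (le_max_left _ _) (le_max_left _ _))) 𝒟
  have eT := hT a haT' S (H.of_le (le_trans (le_max_right _ _) (le_max_left _ _))) 𝒟
  have eO := hO a haO' S (H.of_le (le_max_right _ _)) 𝒟
  -- smoothness, hence the split of `ℛ F`
  have hsm : SmoothData ⟨β, α, a, b⟩ S 𝒟.cut.η 𝒟.D := H.smoothData ha1 (hρ a haρ'' S.q) hc₀ 𝒟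
  have hs := stressScale_nonneg (β := β) (α := α) (b := b) ha1 S.q
  intro t ht x
  rw [hsm.newStress_eq_sum 𝔚 ht x]
  have bT := (eT.norm_le ht x).trans (max_mul_le_max_mul hs)
  have bN := (eN.norm_le ht x).trans (max_mul_le_max_mul hs)
  have bO := (eO.norm_le ht x).trans (max_mul_le_max_mul hs)
  calc _ ≤ _ := norm_add₃_le
    _ ≤ max CT 0 * _ + max CN 0 * _ + max CO 0 * _ := add_le_add (add_le_add bT bN) bO
    _ = _ := by ring

end Assembly

end BDSV

end Literature.Analysis.FluidPDE
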